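import Literature.NumberTheory.Transcendental.BakerField
import Literature.NumberTheory.Transcendental.UnivExtAlgPointsDivision
import Literature.NumberTheory.Transcendental.HeightLocalGlobal
import Literature.NumberTheory.EllipticCurves.HeightsMultiples
import Literature.NumberTheory.EllipticCurves.WeierstrassZetaDivision
import Mathlib.NumberTheory.Height.NumberField
import HarnessLib

/-!
# The number field of Baker's method on `M_κ` at a general algebraic point (heights)

Topic: `Literature/NumberTheory/Transcendental`. A proofs-and-definitions file (no named facts)
of the unit `provefact-Literature.NumberTheory.Transcendental.s-efcbe22610` (fact
`Literature.NumberTheory.Transcendental.semistabilityTheorem_std`, Baker–Wüstholz's Semistability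
Theorem 6.15 for the groups `M_κ = 𝔾ₘ^β × P_κ` at ALL algebraic points).

`BakerField.lean` fixes the number field of Baker's method for a point `v ∈ Std.Alg` whose
`E`-coordinates are TORSION (`TorsionCoords`): then every generator value at `s·v` is periodic in
`s` and has height `≪ s`. The first run of Baker's method at a GENERAL algebraic point (op. cit.
pp. 116–119) needs the same package for points whose `E`-coordinates `z_b` are either lattice
vectors or NON-torsion (every algebraic point has such a multiple `N·v`; the glue is in the
sequel), where the generator values at `s·v` — `℘(s z_b)`, `℘′(s z_b)` and the regularised fibre
coordinates `Ñ_e(s·v)` — are no longer periodic and have height `≪ s²` resp. `≪ s³`. This file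
builds that package with M. Stoll's heights (`Mathlib.NumberTheory.Height`) on the fixed number
field `K`:

* `BakerDataG` — the data: algebraic `g₂, g₃`, a point `v ∈ Std.Alg` given with its
  `E♮`-lifts `t'_b`, REDUCED (`latCo b = some (m, n)`: `z_b = mω₁ + nω₂`; `latCo b = none`:
  `s z_b ∉ Λ` for all `s ≥ 1`), and finitely many algebraic directions;
* `BakerDataG.gens`, `K`, `emb`, `den`, `M` — the field `K = ℚ(g₂, g₃, κ, x_m, e^{y_j}, ℘(z_b),
  ℘′(z_b)/2, τ_b, a_e)` exactly as in `BakerField.lean` (`AlgebraicGeneratorsField.AlgGens`);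
* the `K`-model `WK : y² = x³ − (g₂/4)x − g₃/4` of `E_Λ` (`WK.map emb = L.curve`), its
  `K`-points `PtK b = (℘(z_b), ℘′(z_b)/2)` for the non-lattice `b`, and the coordinates
  `xs s b, ys s b ∈ K` of `s • PtK b` (`emb (xs s b) = ℘(s z_b)`, `emb (ys s b) = ℘′(s z_b)/2`,
  division polynomials, `WeierstrassPMultiplication.lean`, `DivisionPolynomialMultiplication.lean`);
* `BakerDataG.gK s : Gen → K` — **the generator values at `s·v` as elements of `K`**
  (`emb_gK`), the fibre coordinate through the chain
  `ζ(sz) − sζ(z) = ∑_{j<s} (ζ((j+1)z) − ζ(jz) − ζ(z))` of chord/tangent slopes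
  (`PeriodPair.weierstrassZeta_add_holds`, `PeriodPair.weierstrassZeta_two_mul`);
* heights: `logHeight₁ (gK s i) ≤ Cg·(s+1)³` (`logHeight₁_gK_le`) from
  `h(x(sP)) ≤ s²h(P) + (s²+1)C` (`HeightsMultiples.lean`, Néron–Tate) and the height
  inequalities for sums/products/quotients (`Mathlib.NumberTheory.Height.Basic`);
* the interface consumed by the Siegel and Liouville steps of the sequel, in the shape of
  `BakerField.lean` but with per-`s` denominators: `gBound s = Mg^{(s+1)³}` with
  `‖σ(gK s i)‖ ≤ gBound s` (`norm_embedding_gK_le`; conjugates are bounded by the height), and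
  `dAt s ∈ ℤ ∖ 0` with `dAt s · gK s i ∈ 𝓞_K`, `d₁ ∣ dAt s`, `|dAt s| ≤ dBase^{(s+1)³}`
  (`NumberField.exists_nat_le_mulHeight₁`: a denominator is bounded by the height).

## References

* A. Baker, G. Wüstholz, *Logarithmic Forms and Diophantine Geometry*, CUP 2007, §6.8 (pp. 116–119:
  the field `K`, `h(ℓg) ≤ c₃ℓ²h(g) + c₄`, `log max |X_i(sγ)| ≪ s²`, Liouville estimate).
* J. H. Silverman, *The Arithmetic of Elliptic Curves*, 2nd ed., GTM 106, Thm. VIII.9.3, Ex. 3.7.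
-/

noncomputable section

open Complex MvPolynomial Height NumberField
open scoped PeriodPair Polynomial.Bivariate

namespace Literature.NumberTheory.Transcendental

/-! ### Heights: conjugates and denominators are bounded by the height -/

section HeightBridge

variable {K : Type*} [Field K] [NumberField K]

/-- **Every conjugate is bounded by the (relative multiplicative) height**: for an embedding
`σ : K → ℂ` of a number field and `x ∈ K`, `‖σ x‖ ≤ H_K(x) = mulHeight₁ x` (the factor of the
place of `σ` in `H_K(x) = ∏_w max(|x|_w, 1)^{n_w} · ∏_v max(|x|_v, 1)` is `≥ ‖σ x‖`, all others
are `≥ 1`). [folklore] -/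
theorem norm_embedding_le_mulHeight₁ (σ : K →+* ℂ) (x : K) : ‖σ x‖ ≤ mulHeight₁ x := by
  classical
  set w₀ : InfinitePlace K := InfinitePlace.mk σ with hw₀def
  have hw₀ : w₀ x = ‖σ x‖ := InfinitePlace.apply σ x
  rw [NumberField.mulHeight₁_eq, ← hw₀]
  have hfin : (1 : ℝ) ≤ ∏ᶠ v : FinitePlace K, max (v x) 1 :=
    finprod_induction (p := fun r : ℝ => 1 ≤ r) le_rfl (fun _ _ ha hb => one_le_mul_of_one_le_of_one_le ha hb)
      fun v => le_max_right _ _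
  have hinf : w₀ x ≤ ∏ w : InfinitePlace K, max (w x) 1 ^ w.mult := by
    rw [← Finset.mul_prod_erase Finset.univ (fun w : InfinitePlace K => max (w x) 1 ^ w.mult)
      (Finset.mem_univ w₀)]
    have h1 : w₀ x ≤ max (w₀ x) 1 ^ w₀.mult := by
      calc w₀ x ≤ max (w₀ x) 1 := le_max_left _ _
        _ = max (w₀ x) 1 ^ 1 := (pow_one _).symm
        _ ≤ max (w₀ x) 1 ^ w₀.mult :=
          pow_le_pow_right₀ (le_max_right _ _) (Nat.one_le_iff_ne_zero.mpr InfinitePlace.mult_ne_zero)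
    have h2 : (1 : ℝ) ≤ ∏ w ∈ Finset.univ.erase w₀, max (w x) 1 ^ w.mult := by
      calc (1 : ℝ) = ∏ _w ∈ Finset.univ.erase w₀, (1 : ℝ) := Finset.prod_const_one.symm
        _ ≤ ∏ w ∈ Finset.univ.erase w₀, max (w x) 1 ^ w.mult :=
          Finset.prod_le_prod (fun _ _ => zero_le_one) fun w _ => one_le_pow₀ (le_max_right _ _)
    have h0 : 0 ≤ max (w₀ x) 1 ^ w₀.mult := by positivity
    calc w₀ x ≤ max (w₀ x) 1 ^ w₀.mult := h1
      _ = max (w₀ x) 1 ^ w₀.mult * 1 := (mul_one _).symm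
      _ ≤ max (w₀ x) 1 ^ w₀.mult * ∏ w ∈ Finset.univ.erase w₀, max (w x) 1 ^ w.mult :=
        mul_le_mul_of_nonneg_left h2 h0
  have h0 : 0 ≤ ∏ w : InfinitePlace K, max (w x) 1 ^ w.mult := by positivity
  calc w₀ x ≤ ∏ w : InfinitePlace K, max (w x) 1 ^ w.mult := hinf
    _ = (∏ w : InfinitePlace K, max (w x) 1 ^ w.mult) * 1 := (mul_one _).symm
    _ ≤ (∏ w : InfinitePlace K, max (w x) 1 ^ w.mult) * ∏ᶠ v : FinitePlace K, max (v x) 1 :=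
      mul_le_mul_of_nonneg_left hfin h0

/-- Logarithmic form: `‖σ x‖ ≤ exp(logHeight₁ x)`. [folklore] -/
theorem norm_embedding_le_exp_logHeight₁ (σ : K →+* ℂ) (x : K) : ‖σ x‖ ≤ Real.exp (logHeight₁ x) := by
  rw [logHeight₁_eq_log_mulHeight₁, Real.exp_log (mulHeight₁_pos x)]
  exact norm_embedding_le_mulHeight₁ σ x

/-- **A denominator bounded by the height** (Mathlib's `NumberField.exists_nat_le_mulHeight₁`, in
logarithmic form): there is `n ∈ ℕ`, `1 ≤ n ≤ exp(logHeight₁ x)`, with `n·x` an algebraic integer.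
[folklore] -/
theorem exists_nat_den_le_exp_logHeight₁ (x : K) :
    ∃ n : ℕ, 1 ≤ n ∧ (n : ℝ) ≤ Real.exp (logHeight₁ x) ∧ IsIntegral ℤ ((n : K) * x) := by
  obtain ⟨n, hn, hle, hint⟩ := NumberField.exists_nat_le_mulHeight₁ x
  refine ⟨n, Nat.one_le_iff_ne_zero.mpr hn, ?_, hint⟩
  rwa [logHeight₁_eq_log_mulHeight₁, Real.exp_log (mulHeight₁_pos x)]

/-- Height of a natural number in `K`: `logHeight₁ (n : K) ≤ totalWeight K · log n` (`n ≥ 1`).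
[folklore] -/
theorem logHeight₁_natCast_le (n : ℕ) (hn : n ≠ 0) :
    logHeight₁ (n : K) ≤ totalWeight K * Real.log n := by
  rw [logHeight₁_eq_log_mulHeight₁, ← Real.log_pow]
  exact Real.log_le_log (mulHeight₁_pos _) (mulHeight₁_natCast_le n hn)

/-- `logHeight₁ (n : K) ≤ totalWeight K · n`. [folklore] -/
theorem logHeight₁_natCast_le' (n : ℕ) : logHeight₁ (n : K) ≤ totalWeight K * n := by
  rcases Nat.eq_zero_or_pos n with rfl | hn
  · simp
  · refine (logHeight₁_natCast_le n hn.ne').trans ?_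
    exact mul_le_mul_of_nonneg_left (Real.log_le_self (Nat.cast_nonneg n)) (Nat.cast_nonneg _)

/-- `logHeight₁ (x / y) ≤ logHeight₁ x + logHeight₁ y`. [folklore] -/
theorem logHeight₁_div_le (x y : K) : logHeight₁ (x / y) ≤ logHeight₁ x + logHeight₁ y := by
  rw [div_eq_mul_inv]
  calc logHeight₁ (x * y⁻¹) ≤ logHeight₁ x + logHeight₁ y⁻¹ := logHeight₁_mul_le _ _
    _ = logHeight₁ x + logHeight₁ y := by rw [logHeight₁_inv]

end HeightBridge

namespace GaGmE

namespace Std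

variable {β γ δ : Type} [Fintype β] [Fintype γ] [Fintype δ] [DecidableEq γ]

/-! ### The data -/

/-- **The data of Baker's method on `M_κ` at a general (reduced) algebraic point**: algebraic
invariants, a point `v` of `Lie M_κ,ℂ` with `exp(v)` algebraic, given with lifts `t'_b` of its
`E`-coordinates to `ℚ̄`-points `(z_b, t'_b)` of `E♮` and algebraic `a_e = s'_e − ∑_b κ_{eb} t'_b`
(the witnesses of `v ∈ Std.Alg`), REDUCED — each `z_b` is a lattice vector with recorded
coordinates, or has no torsion (`s z_b ∉ Λ`, `s ≥ 1`) — and finitely many directions with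
algebraic coordinates. [cite: BakerWustholz2007, §6.8 (p. 117: the point γ' = exp_G(u))] -/
structure BakerDataG (β γ δ : Type) [Fintype β] [Fintype γ] [Fintype δ] [DecidableEq γ] where
  /-- the period pair -/
  L : PeriodPair
  /-- the extension data of `M_κ` -/
  κM : δ → γ → Kbar
  /-- `g₂ ∈ ℚ̄` -/
  h₂ : IsAlgebraic ℚ L.g₂
  /-- `g₃ ∈ ℚ̄` -/
  h₃ : IsAlgebraic ℚ L.g₃
  /-- the point -/
  v : β ⊕ (γ ⊕ δ) → ℂ
  /-- `e^{y_j} ∈ ℚ̄` -/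
  hy : ∀ j, IsAlgebraic ℚ (cexp (v (iy j)))
  /-- the lifts `t'_b` -/
  t' : γ → ℂ
  /-- `(z_b, t'_b)` is a `ℚ̄`-point of `E♮` -/
  ht' : ∀ b, L.IsUnivExtAlgPoint (v (iz b)) (t' b)
  /-- `a_e = s'_e − ∑_b κ_{eb} t'_b ∈ ℚ̄` -/
  ha : ∀ e, IsAlgebraic ℚ (v (is e) - ∑ b, (κM e b : ℂ) * t' b)
  /-- lattice coordinates of the lattice `E`-coordinates (`none` = non-torsion) -/
  latCo : γ → Option (ℤ × ℤ)
  /-- `latCo b = some (m, n)` means `z_b = mω₁ + nω₂` -/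
  hlat : ∀ b mn, latCo b = some mn → v (iz b) = (mn.1 : ℂ) * L.ω₁ + (mn.2 : ℂ) * L.ω₂
  /-- `latCo b = none` means `s z_b ∉ Λ` for all `s ≥ 1` -/
  hnt : ∀ b, latCo b = none → ∀ s : ℕ, s ≠ 0 → (s : ℂ) * v (iz b) ∉ L.lattice
  /-- number of directions -/
  dd : ℕ
  /-- the directions -/
  xs : Fin dd → β ⊕ (γ ⊕ δ) → ℂ
  /-- their coordinates are algebraic -/
  hxs : ∀ m k, IsAlgebraic ℚ (xs m k)

namespace BakerDataG

variable (B : BakerDataG β γ δ)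

/-- Shorthand: the `b`-th `E`-coordinate `z_b` of the point. [folklore] -/
abbrev z (b : γ) : ℂ := B.v (iz b)

/-- The point lies in `Std.Alg`. [folklore] -/
theorem v_mem_Alg : B.v ∈ Alg B.L B.κM := ⟨B.hy, B.t', B.ht', B.ha⟩

/-- A non-lattice coordinate is off the lattice. [folklore] -/
theorem z_notMem {b : γ} (hb : B.latCo b = none) : B.z b ∉ B.L.lattice := by
  simpa using B.hnt b hb 1 one_ne_zero

/-- A non-lattice coordinate has all its positive multiples off the lattice. [folklore] -/
theorem nat_mul_z_notMem {b : γ} (hb : B.latCo b = none) {s : ℕ} (hs : s ≠ 0) :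
    (s : ℂ) * B.z b ∉ B.L.lattice := B.hnt b hb s hs

/-- A lattice coordinate, as a lattice vector. [folklore] -/
theorem z_eq_of_some {b : γ} {mn : ℤ × ℤ} (hb : B.latCo b = some mn) :
    B.z b = (mn.1 : ℂ) * B.L.ω₁ + (mn.2 : ℂ) * B.L.ω₂ := B.hlat b mn hb

/-- A lattice coordinate lies in the lattice, together with its multiples. [folklore] -/
theorem nat_mul_z_mem_of_some {b : γ} {mn : ℤ × ℤ} (hb : B.latCo b = some mn) (s : ℕ) :
    (s : ℂ) * B.z b ∈ B.L.lattice := by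
  rw [B.z_eq_of_some hb, show (s : ℂ) * ((mn.1 : ℂ) * B.L.ω₁ + (mn.2 : ℂ) * B.L.ω₂) =
    ((s * mn.1 : ℤ) : ℂ) * B.L.ω₁ + ((s * mn.2 : ℤ) : ℂ) * B.L.ω₂ by push_cast; ring]
  exact B.L.int_mul_add_int_mul_mem_lattice _ _

/-- `s·z_b ∈ Λ ↔ (b is a lattice coordinate) ∨ s = 0`. [folklore] -/
theorem nat_mul_z_mem_iff (b : γ) (s : ℕ) :
    (s : ℂ) * B.z b ∈ B.L.lattice ↔ B.latCo b ≠ none ∨ s = 0 := by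
  constructor
  · intro h
    by_contra hno
    push Not at hno
    exact B.nat_mul_z_notMem hno.1 hno.2 h
  · rintro (h | rfl)
    · obtain ⟨mn, hmn⟩ := Option.ne_none_iff_exists'.mp h
      exact B.nat_mul_z_mem_of_some hmn s
    · simp

/-- The `ℚ̄`-part `τ_b` of the lift: `t'_b − (mη₁ + nη₂)` for a lattice coordinate
`z_b = mω₁ + nω₂`, `t'_b − ζ(z_b)` otherwise. [folklore] -/
def tau (b : γ) : ℂ :=
  match B.latCo b with
  | some mn => B.t' b - ((mn.1 : ℂ) * B.L.η₁ + (mn.2 : ℂ) * B.L.η₂)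
  | none => B.t' b - B.L.weierstrassZeta (B.z b)

/-- `τ_b` is algebraic. [folklore] -/
theorem isAlgebraic_tau (b : γ) : IsAlgebraic ℚ (B.tau b) := by
  unfold tau
  rcases hb : B.latCo b with _ | mn
  · simp only
    rcases B.ht' b with ⟨m, n, hz, -⟩ | ⟨-, -, hζ⟩
    · have hmem : B.z b ∈ B.L.lattice := by
        change B.v (iz b) ∈ B.L.lattice
        rw [hz]; exact B.L.int_mul_add_int_mul_mem_lattice m n
      exact absurd hmem (B.z_notMem hb)
    · exact hζ
  · simp only
    rcases B.ht' b with ⟨m, n, hz, halg⟩ | ⟨hnot, -, -⟩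
    · have hz' := B.z_eq_of_some hb
      rw [show B.z b = B.v (iz b) from rfl] at hz'
      rw [hz'] at hz
      obtain ⟨h1, h2⟩ := PeriodPair.int_coords_unique hz
      rw [h1, h2]; exact halg
    · have hmem : B.v (iz b) ∈ B.L.lattice := by simpa using B.nat_mul_z_mem_of_some hb 1
      exact absurd hmem hnot

/-- `x_b = ℘(z_b)` for a non-lattice coordinate (`0` for a lattice one). [folklore] -/
def px (b : γ) : ℂ := match B.latCo b with | some _ => 0 | none => ℘[B.L] (B.z b)

/-- `y_b = ℘′(z_b)/2` for a non-lattice coordinate (`0` for a lattice one). [folklore] -/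
def py (b : γ) : ℂ := match B.latCo b with | some _ => 0 | none => ℘'[B.L] (B.z b) / 2

/-- `x_b` is algebraic. [folklore] -/
theorem isAlgebraic_px (b : γ) : IsAlgebraic ℚ (B.px b) := by
  unfold px
  rcases hb : B.latCo b with _ | mn
  · simp only
    rcases B.ht' b with ⟨m, n, hz, -⟩ | ⟨-, h℘, -⟩
    · have hmem : B.z b ∈ B.L.lattice := by
        change B.v (iz b) ∈ B.L.lattice
        rw [hz]; exact B.L.int_mul_add_int_mul_mem_lattice m n
      exact absurd hmem (B.z_notMem hb)
    · exact h℘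
  · simpa using isAlgebraic_zero

/-- `y_b` is algebraic. [folklore] -/
theorem isAlgebraic_py (b : γ) : IsAlgebraic ℚ (B.py b) := by
  unfold py
  rcases hb : B.latCo b with _ | mn
  · simp only
    have h℘ : IsAlgebraic ℚ (℘[B.L] (B.z b)) := by
      have := B.isAlgebraic_px b; unfold px at this; rw [hb] at this; exact this
    have h' := B.L.isAlgebraic_derivWeierstrassP (B.z_notMem hb) B.h₂ B.h₃ h℘
    have e : ℘'[B.L] (B.z b) / 2 = (2 : ℚ)⁻¹ • ℘'[B.L] (B.z b) := by
      rw [Rat.smul_def]; push_cast; ring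
    rw [e]
    exact h'.smul _
  · simpa using isAlgebraic_zero

/-- `a_e = s'_e − ∑_b κ_{eb} t'_b`. [folklore] -/
def aa (e : δ) : ℂ := B.v (is e) - ∑ b, (B.κM e b : ℂ) * B.t' b

/-! ### The generators of the field `K` -/

/-- Index type of the algebraic data generating `K`: `g₂, g₃, κ_{eb}`, direction coordinates,
`e^{y_j}`, `x_b, y_b, τ_b`, `a_e`. The first four constructors are those of
`BakerField.BakerData.BIdx` (same names, so that the `K`-models of `BakerModels.lean` port verbatim).
[folklore] -/
inductive BIdx (B : BakerDataG β γ δ) : Type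
  | g2 : BIdx B
  | g3 : BIdx B
  | kap : δ → γ → BIdx B
  | dir : Fin B.dd → β ⊕ (γ ⊕ δ) → BIdx B
  | tor : β → BIdx B
  | px : γ → BIdx B
  | py : γ → BIdx B
  | tau : γ → BIdx B
  | aa : δ → BIdx B

/-- The index type is finite. [folklore] -/
instance instFintypeBIdx : Fintype B.BIdx := by
  classical
  exact Fintype.ofEquiv
    (Unit ⊕ Unit ⊕ (δ × γ) ⊕ (Fin B.dd × (β ⊕ (γ ⊕ δ))) ⊕ β ⊕ γ ⊕ γ ⊕ γ ⊕ δ)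
    { toFun := fun t => match t with
        | Sum.inl _ => BIdx.g2
        | Sum.inr (Sum.inl _) => BIdx.g3
        | Sum.inr (Sum.inr (Sum.inl ⟨e, b⟩)) => BIdx.kap e b
        | Sum.inr (Sum.inr (Sum.inr (Sum.inl ⟨m, k⟩))) => BIdx.dir m k
        | Sum.inr (Sum.inr (Sum.inr (Sum.inr (Sum.inl j)))) => BIdx.tor j
        | Sum.inr (Sum.inr (Sum.inr (Sum.inr (Sum.inr (Sum.inl b))))) => BIdx.px b
        | Sum.inr (Sum.inr (Sum.inr (Sum.inr (Sum.inr (Sum.inr (Sum.inl b)))))) => BIdx.py b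
        | Sum.inr (Sum.inr (Sum.inr (Sum.inr (Sum.inr (Sum.inr (Sum.inr (Sum.inl b))))))) => BIdx.tau b
        | Sum.inr (Sum.inr (Sum.inr (Sum.inr (Sum.inr (Sum.inr (Sum.inr (Sum.inr e))))))) => BIdx.aa e
      invFun := fun t => match t with
        | BIdx.g2 => Sum.inl ()
        | BIdx.g3 => Sum.inr (Sum.inl ())
        | BIdx.kap e b => Sum.inr (Sum.inr (Sum.inl ⟨e, b⟩))
        | BIdx.dir m k => Sum.inr (Sum.inr (Sum.inr (Sum.inl ⟨m, k⟩)))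
        | BIdx.tor j => Sum.inr (Sum.inr (Sum.inr (Sum.inr (Sum.inl j))))
        | BIdx.px b => Sum.inr (Sum.inr (Sum.inr (Sum.inr (Sum.inr (Sum.inl b)))))
        | BIdx.py b => Sum.inr (Sum.inr (Sum.inr (Sum.inr (Sum.inr (Sum.inr (Sum.inl b))))))
        | BIdx.tau b => Sum.inr (Sum.inr (Sum.inr (Sum.inr (Sum.inr (Sum.inr (Sum.inr (Sum.inl b)))))))
        | BIdx.aa e => Sum.inr (Sum.inr (Sum.inr (Sum.inr (Sum.inr (Sum.inr (Sum.inr (Sum.inr e)))))))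
      left_inv := fun t => by
        rcases t with _ | _ | ⟨_, _⟩ | ⟨_, _⟩ | _ | _ | _ | _ | _ <;> rfl
      right_inv := fun t => by cases t <;> rfl }

/-- The algebraic data. [folklore] -/
def aVal : B.BIdx → ℂ
  | BIdx.g2 => B.L.g₂
  | BIdx.g3 => B.L.g₃
  | BIdx.kap e b => (B.κM e b : ℂ)
  | BIdx.dir m k => B.xs m k
  | BIdx.tor j => cexp (B.v (iy j))
  | BIdx.px b => B.px b
  | BIdx.py b => B.py b
  | BIdx.tau b => B.tau b
  | BIdx.aa e => B.aa e

/-- All the data are algebraic. [folklore] -/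
theorem isAlgebraic_aVal (t : B.BIdx) : IsAlgebraic ℚ (B.aVal t) := by
  cases t with
  | g2 => exact B.h₂
  | g3 => exact B.h₃
  | kap e b => exact isAlgebraic_coe_Kbar _
  | dir m k => exact B.hxs m k
  | tor j => exact B.hy j
  | px b => exact B.isAlgebraic_px b
  | py b => exact B.isAlgebraic_py b
  | tau b => exact B.isAlgebraic_tau b
  | aa e => exact B.ha e

/-- **The finite family of algebraic numbers of Baker's method on `M_κ` at a general point.**
[cite: BakerWustholz2007, §6.8 (p. 117: the field K)] -/
def gens : AlgGens := ⟨B.BIdx, B.aVal, B.isAlgebraic_aVal⟩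

/-- The number field `K`. [cite: BakerWustholz2007, §6.8] -/
abbrev K : IntermediateField ℚ ℂ := B.gens.K

/-- The inclusion `K ⊂ ℂ` as a ring map. [folklore] -/
abbrev emb : B.K →+* ℂ := algebraMap B.K ℂ

/-- The `K`-valued datum with index `t`. [folklore] -/
abbrev gK' (t : B.BIdx) : B.K := B.gens.genK t

/-- `emb (gK' t) = aVal t`. [folklore] -/
@[simp] theorem emb_gK' (t : B.BIdx) : B.emb (B.gK' t) = B.aVal t := rfl

/-- `emb` is injective. [folklore] -/
theorem emb_injective : Function.Injective B.emb := (algebraMap B.K ℂ).injective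

/-- The common denominator of the data. [folklore] -/
abbrev den : ℤ := B.gens.den

/-- The conjugate bound of the data (`≥ 1`). [folklore] -/
abbrev M : ℝ := B.gens.M

/-! ### The `K`-model of `E_Λ` and its `K`-points -/

/-- `g₂ ∈ K`, `g₃ ∈ K`. [folklore] -/
abbrev g2K : B.K := B.gK' BIdx.g2
/-- `g₃ ∈ K`. [folklore] -/
abbrev g3K : B.K := B.gK' BIdx.g3
/-- `x_b ∈ K`. [folklore] -/
abbrev pxK (b : γ) : B.K := B.gK' (BIdx.px b)
/-- `y_b ∈ K`. [folklore] -/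
abbrev pyK (b : γ) : B.K := B.gK' (BIdx.py b)
/-- `τ_b ∈ K`. [folklore] -/
abbrev tauK (b : γ) : B.K := B.gK' (BIdx.tau b)
/-- `a_e ∈ K`. [folklore] -/
abbrev aaK (e : δ) : B.K := B.gK' (BIdx.aa e)
/-- `κ_{eb} ∈ K`. [folklore] -/
abbrev κK (e : δ) (b : γ) : B.K := B.gK' (BIdx.kap e b)
/-- `e^{y_j} ∈ K`. [folklore] -/
abbrev torK (j : β) : B.K := B.gK' (BIdx.tor j)

/-- **The `K`-model `WK : y² = x³ − (g₂/4)x − g₃/4` of `E_Λ`.** [folklore] -/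
def WK : WeierstrassCurve B.K := ⟨0, 0, 0, -B.g2K / 4, -B.g3K / 4⟩

/-- `WK ⊗_K ℂ = E_Λ`. [folklore] -/
theorem WK_map : B.WK.map B.emb = B.L.curve := by
  refine PeriodPair.map_eq_curve ?_ ?_
  · show ((-B.g2K / 4 : B.K) : ℂ) = -B.L.g₂ / 4
    push_cast
    rfl
  · show ((-B.g3K / 4 : B.K) : ℂ) = -B.L.g₃ / 4
    push_cast
    rfl

/-- `WK` is an elliptic curve. [folklore] -/
instance isElliptic_WK : B.WK.IsElliptic := by
  rw [WeierstrassCurve.isElliptic_iff]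
  have h : B.emb B.WK.Δ = B.L.curve.Δ := by rw [← B.WK_map, WeierstrassCurve.map_Δ]
  have hne : B.WK.Δ ≠ 0 := by
    intro h0
    have : B.L.curve.Δ = 0 := by rw [← h, h0, map_zero]
    exact B.L.isElliptic_curve.isUnit.ne_zero this
  exact isUnit_iff_ne_zero.mpr hne

/-- For a non-lattice coordinate, `(x_b, y_b)` maps to `(℘(z_b), ℘′(z_b)/2)`. [folklore] -/
theorem emb_pxK_pyK {b : γ} (hb : B.latCo b = none) :
    B.emb (B.pxK b) = ℘[B.L] (B.z b) ∧ B.emb (B.pyK b) = ℘'[B.L] (B.z b) / 2 := by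
  simp only [emb_gK', aVal, px, py, hb]
  exact ⟨trivial, trivial⟩

/-- For a non-lattice coordinate, `(x_b, y_b)` is a (nonsingular) `K`-point of `WK`. [folklore] -/
theorem nonsingular_pxK_pyK {b : γ} (hb : B.latCo b = none) : B.WK.toAffine.Nonsingular (B.pxK b) (B.pyK b) := by
  have h := PeriodPair.nonsingular_weierstrassP (B.z_notMem hb)
  rw [← (B.emb_pxK_pyK hb).1, ← (B.emb_pxK_pyK hb).2, ← B.WK_map] at h
  exact (WeierstrassCurve.Affine.map_nonsingular (W := B.WK.toAffine) B.emb_injective _ _).mp h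

/-- **The `K`-point `P_b = (x_b, y_b)` of `WK`** for a non-lattice coordinate. [folklore] -/
def PtK {b : γ} (hb : B.latCo b = none) : B.WK.toAffine.Point :=
  .some (B.pxK b) (B.pyK b) (B.nonsingular_pxK_pyK hb)

/-- The value `ψ_s(x_b, y_b) ∈ K` of the `s`-th division polynomial at `P_b`. [folklore] -/
def psiK (s : ℕ) (b : γ) : B.K := (B.WK.ψ s).evalEval (B.pxK b) (B.pyK b)

/-- `emb ψ_s(P_b) = ψ_s(℘ z_b, ℘′ z_b/2)` (division polynomial of `E_Λ`). [folklore] -/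
theorem emb_psiK {b : γ} (hb : B.latCo b = none) (s : ℕ) :
    B.emb (B.psiK s b) = (B.L.curve.ψ s).evalEval (℘[B.L] (B.z b)) (℘'[B.L] (B.z b) / 2) := by
  rw [psiK, ← Polynomial.map_mapRingHom_evalEval, ← WeierstrassCurve.map_ψ, B.WK_map, (B.emb_pxK_pyK hb).1,
    (B.emb_pxK_pyK hb).2]

/-- `ψ_s(P_b) ≠ 0` for `s ≥ 1` (non-torsion). [folklore] -/
theorem psiK_ne_zero {b : γ} (hb : B.latCo b = none) {s : ℕ} (hs : s ≠ 0) : B.psiK s b ≠ 0 := by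
  intro h0
  have h1 : (B.L.curve.ψ s).evalEval (℘[B.L] (B.z b)) (℘'[B.L] (B.z b) / 2) = 0 := by
    rw [← B.emb_psiK hb s, h0, map_zero]
  have := (B.L.evalEval_ψ_eq_zero_iff (B.z_notMem hb) (s : ℤ)).mp (by exact_mod_cast h1)
  exact B.nat_mul_z_notMem hb hs (by exact_mod_cast this)

/-- The coordinates `x(sP_b) = φ_s/ψ_s²`, `y(sP_b) = ω_s/ψ_s³` of the multiple `s • P_b` in `K`.
[cite: SilvermanAEC2009, Exercise 3.7(d)] -/
def xsK (s : ℕ) (b : γ) : B.K := (B.WK.φ s).evalEval (B.pxK b) (B.pyK b) / B.psiK s b ^ 2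

/-- The `y`-coordinate of `s • P_b` in `K`. [cite: SilvermanAEC2009, Exercise 3.7(d)] -/
def ysK (s : ℕ) (b : γ) : B.K :=
  WeierstrassCurve.Affine.Point.ωEval B.WK (B.pxK b) (B.pyK b) s / B.psiK s b ^ 3

/-- **`s • P_b = (xsK s b, ysK s b)`** in `WK(K)`, for a non-lattice `b` and `s ≥ 1`.
[cite: SilvermanAEC2009, Exercise 3.7(d)] -/
theorem nsmul_PtK {b : γ} (hb : B.latCo b = none) {s : ℕ} (hs : s ≠ 0) :
    ∃ hns : B.WK.toAffine.Nonsingular (B.xsK s b) (B.ysK s b), s • B.PtK hb = .some _ _ hns := by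
  obtain ⟨hns, e⟩ := WeierstrassCurve.Affine.Point.zsmul_some_eq_of_evalEval_ψ_ne_zero
    (B.nonsingular_pxK_pyK hb) (n := (s : ℤ)) (by simpa [psiK] using B.psiK_ne_zero hb hs)
  refine ⟨by simpa [xsK, ysK, psiK] using hns, ?_⟩
  rw [PtK, ← natCast_zsmul, e]
  congr 1

/-- The specialisation map of the universal pointed curve commutes with `emb`. [folklore] -/
theorem emb_comp_ev (x y : B.K) :
    B.emb.comp (Literature.NumberTheory.EllipticCurves.UnivEC.ev B.WK x y) =
      Literature.NumberTheory.EllipticCurves.UnivEC.ev (B.WK.map B.emb) (B.emb x) (B.emb y) := by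
  refine MvPolynomial.ringHom_ext (fun n => by simp [Literature.NumberTheory.EllipticCurves.UnivEC.ev]) fun i => ?_
  simp only [Literature.NumberTheory.EllipticCurves.UnivEC.ev, RingHom.coe_comp, Function.comp_apply,
    MvPolynomial.eval₂Hom_X']
  fin_cases i <;> simp [WeierstrassCurve.map]

/-- **`emb x(sP_b) = ℘(s z_b)` and `emb y(sP_b) = ℘′(s z_b)/2`** (`s ≥ 1`, non-lattice `b`).
[cite: SilvermanAEC2009, Exercise 3.7(d) with Prop. VI.3.6(b)] -/
theorem emb_xsK_ysK {b : γ} (hb : B.latCo b = none) {s : ℕ} (hs : s ≠ 0) :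
    B.emb (B.xsK s b) = ℘[B.L] ((s : ℂ) * B.z b) ∧ B.emb (B.ysK s b) = ℘'[B.L] ((s : ℂ) * B.z b) / 2 := by
  have hz := B.z_notMem hb
  have hsz : ((s : ℤ) : ℂ) * B.z b ∉ B.L.lattice := by exact_mod_cast B.nat_mul_z_notMem hb hs
  obtain ⟨ex, ey⟩ := B.L.weierstrassP_int_mul hz hsz
  have hψ : B.emb (B.psiK s b) = (B.L.curve.ψ s).evalEval (℘[B.L] (B.z b)) (℘'[B.L] (B.z b) / 2) :=
    B.emb_psiK hb s
  constructor
  · rw [xsK, map_div₀, map_pow, hψ, ← Polynomial.map_mapRingHom_evalEval, ← WeierstrassCurve.map_φ, B.WK_map,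
      (B.emb_pxK_pyK hb).1, (B.emb_pxK_pyK hb).2]
    exact_mod_cast ex.symm
  · rw [ysK, map_div₀, map_pow, hψ]
    have hω : B.emb (WeierstrassCurve.Affine.Point.ωEval B.WK (B.pxK b) (B.pyK b) s) =
        WeierstrassCurve.Affine.Point.ωEval B.L.curve (℘[B.L] (B.z b)) (℘'[B.L] (B.z b) / 2) s := by
      rw [WeierstrassCurve.Affine.Point.ωEval, WeierstrassCurve.Affine.Point.ωEval,
        ← RingHom.comp_apply, B.emb_comp_ev, B.WK_map, (B.emb_pxK_pyK hb).1, (B.emb_pxK_pyK hb).2]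
    rw [hω]
    exact_mod_cast ey.symm

/-! ### The `ζ`-chain: `ζ(sz) − sζ(z)` as a sum of slopes -/

/-- The slope used in the step `jP_b ↦ (j+1)P_b`: the tangent slope `(3x² + a₄)/(2y)` for `j = 1`,
the chord slope `(y(jP) − y(P))/(x(jP) − x(P))` for `j ≥ 2`. [folklore] -/
def slopeK (j : ℕ) (b : γ) : B.K :=
  if j = 1 then (3 * B.pxK b ^ 2 + (-B.g2K / 4)) / (2 * B.pyK b)
  else (B.ysK j b - B.pyK b) / (B.xsK j b - B.pxK b)

/-- The `ζ`-chain `Z_s = ∑_{1 ≤ j < s} slope_j ∈ K`. [folklore] -/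
def ZK (s : ℕ) (b : γ) : B.K := ∑ j ∈ Finset.Ico 1 s, B.slopeK j b

/-- **`emb (slope_j) = ζ((j+1)z_b) − ζ(jz_b) − ζ(z_b)`** for a non-lattice `b` and `j ≥ 1`: the
addition theorem `ζ(u+v) − ζ(u) − ζ(v) = ½(℘′u − ℘′v)/(℘u − ℘v)` (`PeriodPair.weierstrassZeta_add_holds`)
resp. the duplication formula `ζ(2u) − 2ζ(u) = ℘″(u)/(2℘′(u))` (`PeriodPair.weierstrassZeta_two_mul`).
[cite: ArmitageEberlein2001, §7.4.2 eq. (7.66)] -/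
theorem emb_slopeK {b : γ} (hb : B.latCo b = none) {j : ℕ} (hj : j ≠ 0) :
    B.emb (B.slopeK j b) = B.L.weierstrassZeta (((j : ℂ) + 1) * B.z b) - B.L.weierstrassZeta ((j : ℂ) * B.z b) -
      B.L.weierstrassZeta (B.z b) := by
  have hz := B.z_notMem hb
  obtain ⟨hx, hy⟩ := B.emb_pxK_pyK hb
  by_cases h1 : j = 1
  · subst h1
    have h2z : (2 : ℂ) * B.z b ∉ B.L.lattice := by exact_mod_cast B.nat_mul_z_notMem hb (s := 2) two_ne_zero
    have h' : ℘'[B.L] (B.z b) ≠ 0 := fun h0 => h2z ((B.L.derivWeierstrassP_eq_zero_iff hz).mp h0)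
    rw [slopeK, if_pos rfl, map_div₀]
    simp only [map_add, map_mul, map_pow, map_neg, map_div₀, map_ofNat, hx, hy]
    rw [show ((1 : ℕ) : ℂ) + 1 = 2 by norm_num, Nat.cast_one, one_mul, B.L.weierstrassZeta_two_mul hz h',
      B.L.deriv_derivWeierstrassP hz]
    have hg : B.emb B.g2K = B.L.g₂ := rfl
    rw [hg]
    field_simp
    ring
  · have hj2 : 2 ≤ j := by omega
    have hjz : (j : ℂ) * B.z b ∉ B.L.lattice := B.nat_mul_z_notMem hb hj
    have hne : ℘[B.L] ((j : ℂ) * B.z b) ≠ ℘[B.L] (B.z b) := by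
      intro heq
      rcases (B.L.weierstrassP_eq_weierstrassP_iff hjz hz).mp heq with h | h
      · have : ((j + 1 : ℕ) : ℂ) * B.z b ∈ B.L.lattice := by push_cast; rw [add_mul, one_mul]; exact h
        exact B.nat_mul_z_notMem hb (Nat.succ_ne_zero j) this
      · have : ((j - 1 : ℕ) : ℂ) * B.z b ∈ B.L.lattice := by
          rw [Nat.cast_sub (by omega : 1 ≤ j)]; push_cast; rw [sub_mul, one_mul]; exact h
        exact B.nat_mul_z_notMem hb (by omega) this
    have hadd := PeriodPair.weierstrassZeta_add_holds (L := B.L) _ _ hjz hz hne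
    obtain ⟨ex, ey⟩ := B.emb_xsK_ysK hb hj
    rw [slopeK, if_neg h1, map_div₀, map_sub, map_sub, ex, ey, hx, hy, add_mul, one_mul, hadd]
    field_simp
    ring

/-- **`emb (Z_s) = ζ(sz_b) − sζ(z_b)`** for a non-lattice `b` and `s ≥ 1` (telescoping).
[cite: SilvermanAEC2009, Exercise 6.15 (logarithmic derivative)] -/
theorem emb_ZK {b : γ} (hb : B.latCo b = none) {s : ℕ} (hs : s ≠ 0) :
    B.emb (B.ZK s b) = B.L.weierstrassZeta ((s : ℂ) * B.z b) - (s : ℂ) * B.L.weierstrassZeta (B.z b) := by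
  induction s with
  | zero => exact absurd rfl hs
  | succ s ih =>
    rcases Nat.eq_zero_or_pos s with rfl | hs0
    · simp [ZK]
    · rw [ZK, Finset.sum_Ico_succ_top (by omega : 1 ≤ s), map_add, ← ZK, ih hs0.ne', B.emb_slopeK hb hs0.ne']
      push_cast
      ring

/-! ### The generator values at `s·v` over `K` -/

/-- The fibre contribution of the `b`-th `E`-coordinate at `s·v`: `s·τ_b` for a lattice
coordinate, `s·τ_b − Z_s` (resp. `0` at `s = 0`) for a non-lattice one. [folklore] -/
def fibK (s : ℕ) (b : γ) : B.K :=
  match B.latCo b with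
  | some _ => (s : B.K) * B.tauK b
  | none => if s = 0 then 0 else (s : B.K) * B.tauK b - B.ZK s b

/-- The factor generators at `s·v`: `0` in the origin chart (lattice coordinate or `s = 0`),
`(℘(sz_b), ℘′(sz_b)) = (xsK, 2·ysK)` otherwise. [folklore] -/
def facK (s : ℕ) (b : γ) (i : Fin 2) : B.K :=
  match B.latCo b with
  | some _ => 0
  | none => if s = 0 then 0 else if i = 0 then B.xsK s b else 2 * B.ysK s b

/-- **The generator values at `s·v` as elements of `K`.** [cite: BakerWustholz2007, §6.8 (p. 119)] -/
def gK (s : ℕ) : Gen β γ δ → B.K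
  | Sum.inl j => B.torK j ^ s
  | Sum.inr (Sum.inl (b, i)) => B.facK s b i
  | Sum.inr (Sum.inr e) => (s : B.K) * B.aaK e + ∑ b, B.κK e b * B.fibK s b

/-- The adapted chart at `s·v` is the origin chart exactly at the lattice coordinates (and
everywhere at `s = 0`). [folklore] -/
theorem chartChoiceAt_smul (s : ℕ) (b : γ) :
    chartChoiceAt B.L (β := β) (δ := δ) ((s : ℂ) • B.v) b = decide (B.latCo b ≠ none ∨ s = 0) := by
  unfold chartChoiceAt
  simp only [Pi.smul_apply, smul_eq_mul]
  by_cases h : (s : ℂ) * B.v (iz b) ∈ B.L.lattice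
  · rw [if_pos h]
    exact (decide_eq_true ((B.nat_mul_z_mem_iff b s).mp h)).symm
  · rw [if_neg h]
    exact (decide_eq_false (fun h' => h ((B.nat_mul_z_mem_iff b s).mpr h'))).symm

/-- The `ζ̂`-value at `s z_b` in the adapted chart: `s·(mη₁ + nη₂)` for a lattice coordinate,
`0` at `s = 0`, `ζ(s z_b)` otherwise. [folklore] -/
theorem zetaHat_smul (s : ℕ) (b : γ) :
    zetaHat B.L (chartChoiceAt B.L (β := β) (δ := δ) ((s : ℂ) • B.v) b) ((s : ℂ) * B.z b) =
      match B.latCo b with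
      | some mn => (s : ℂ) * ((mn.1 : ℂ) * B.L.η₁ + (mn.2 : ℂ) * B.L.η₂)
      | none => if s = 0 then 0 else B.L.weierstrassZeta ((s : ℂ) * B.z b) := by
  rw [B.chartChoiceAt_smul]
  rcases hb : B.latCo b with _ | mn
  · by_cases hs : s = 0
    · subst hs
      simp only [ne_eq, not_true_eq_false, or_true, decide_true, Nat.cast_zero, zero_mul, if_true, zetaHat_true]
      simpa using (B.L.latU_latP_latG_lattice 0 0).2.2.2
    · simp [hs]
  · simp only [ne_eq, reduceCtorEq, not_false_eq_true, true_or, decide_true, zetaHat_true]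
    rw [B.z_eq_of_some hb, show (s : ℂ) * ((mn.1 : ℂ) * B.L.ω₁ + (mn.2 : ℂ) * B.L.ω₂) =
      ((s * mn.1 : ℤ) : ℂ) * B.L.ω₁ + ((s * mn.2 : ℤ) : ℂ) * B.L.ω₂ by push_cast; ring,
      (B.L.latU_latP_latG_lattice _ _).2.2.2]
    push_cast; ring

/-- The factor generators at `s z_b` in the adapted chart. [folklore] -/
theorem factorGen_smul (s : ℕ) (b : γ) (i : Fin 2) :
    factorGen B.L (chartChoiceAt B.L (β := β) (δ := δ) ((s : ℂ) • B.v) b) i ((s : ℂ) * B.z b) =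
      B.emb (B.facK s b i) := by
  rw [B.chartChoiceAt_smul]
  unfold facK
  rcases hb : B.latCo b with _ | mn
  · by_cases hs : s = 0
    · subst hs
      simp only [ne_eq, not_true_eq_false, or_true, decide_true, Nat.cast_zero, zero_mul, factorGen_true, if_true,
        map_zero]
      have h0 := B.L.latU_latP_latG_lattice 0 0
      simp only [Int.cast_zero, zero_mul, add_zero] at h0
      fin_cases i
      · simpa using h0.2.1
      · simpa using h0.2.2.1
    · simp only [ne_eq, not_true_eq_false, hs, or_self, decide_false, factorGen_false, if_false]
      obtain ⟨ex, ey⟩ := B.emb_xsK_ysK hb hs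
      fin_cases i
      · simpa using ex.symm
      · simp only [Fin.mk_one, Fin.isValue, Matrix.cons_val_one, Matrix.cons_val_fin_one, one_ne_zero, if_false,
          map_mul, map_ofNat, ey]
        ring
  · simp only [ne_eq, reduceCtorEq, not_false_eq_true, true_or, decide_true, factorGen_true, map_zero]
    rw [B.z_eq_of_some hb, show (s : ℂ) * ((mn.1 : ℂ) * B.L.ω₁ + (mn.2 : ℂ) * B.L.ω₂) =
      ((s * mn.1 : ℤ) : ℂ) * B.L.ω₁ + ((s * mn.2 : ℤ) : ℂ) * B.L.ω₂ by push_cast; ring]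
    have h0 := B.L.latU_latP_latG_lattice (s * mn.1) (s * mn.2)
    fin_cases i
    · simpa using h0.2.1
    · simpa using h0.2.2.1

/-- The fibre contribution at `s·v`: `emb (fibK s b) = s t'_b − ζ̂(s z_b)`. [folklore] -/
theorem emb_fibK (s : ℕ) (b : γ) :
    B.emb (B.fibK s b) = (s : ℂ) * B.t' b -
      zetaHat B.L (chartChoiceAt B.L (β := β) (δ := δ) ((s : ℂ) • B.v) b) ((s : ℂ) * B.z b) := by
  rw [B.zetaHat_smul]
  unfold fibK
  rcases hb : B.latCo b with _ | mn
  · by_cases hs : s = 0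
    · subst hs; simp
    · simp only [hs, if_false, map_sub, map_mul, map_natCast, B.emb_ZK hb hs]
      have ht : B.emb (B.tauK b) = B.t' b - B.L.weierstrassZeta (B.z b) := by
        rw [emb_gK']; simp only [aVal]; unfold tau; rw [hb]
      rw [ht]; ring
  · simp only [map_mul, map_natCast]
    have ht : B.emb (B.tauK b) = B.t' b - ((mn.1 : ℂ) * B.L.η₁ + (mn.2 : ℂ) * B.L.η₂) := by
      rw [emb_gK']; simp only [aVal]; unfold tau; rw [hb]
    rw [ht]; ring

/-- **`gK s` are the generator values at `s·v`** (adapted chart, any direction). [folklore] -/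
theorem emb_gK (s : ℕ) (x : β ⊕ (γ ⊕ δ) → ℂ) (i : Gen β γ δ) :
    B.emb (B.gK s i) = genFun B.L B.κM (chartChoiceAt B.L ((s : ℂ) • B.v)) ((s : ℂ) • B.v) x 0 i := by
  rcases i with j | ⟨b, i⟩ | e
  · simp only [gK, map_pow, emb_gK', aVal]
    rw [genFun_torus_mul]
  · simp only [gK]
    rw [BakerData.genFun_zero_eq_genFun_zero _ _ _ _ x]
    simp only [genFun, Pi.smul_apply, smul_eq_mul, zero_mul, add_zero]
    exact (B.factorGen_smul s b i).symm
  · simp only [gK, map_add, map_sum, map_mul, map_natCast, emb_gK', B.emb_fibK]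
    rw [BakerData.genFun_zero_eq_genFun_zero _ _ _ _ x]
    simp only [genFun, Pi.smul_apply, smul_eq_mul, zero_mul, add_zero, aVal, aa]
    have hz : ∀ b', B.v (iz b') = B.z b' := fun _ => rfl
    simp only [hz, mul_sub, Finset.sum_sub_distrib]
    have e1 : ∑ b', (B.κM e b' : ℂ) * ((s : ℂ) * B.t' b') = (s : ℂ) * ∑ b', (B.κM e b' : ℂ) * B.t' b' := by
      rw [Finset.mul_sum]; exact Finset.sum_congr rfl fun b' _ => by ring
    rw [e1]
    ring

/-! ### Heights of the generator values -/

section Heights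

/-- Shorthand for the weight `totalWeight K` (`= [K:ℚ]`) as a real number. [folklore] -/
abbrev tw : ℝ := (totalWeight B.K : ℝ)

omit [Fintype β] [Fintype δ] [DecidableEq γ] in
/-- Elementary: `1 ≤ (s+1)`, `(s+1) ≤ (s+1)²  ≤ (s+1)³` and `s ≤ (s+1)³`, `s² ≤ (s+1)³` for `s ∈ ℕ`,
packaged as the four inequalities used below. [folklore] -/
theorem cube_facts (s : ℕ) :
    (1 : ℝ) ≤ ((s : ℝ) + 1) ^ 3 ∧ (s : ℝ) ≤ ((s : ℝ) + 1) ^ 3 ∧ ((s : ℝ) + 1) ^ 2 ≤ ((s : ℝ) + 1) ^ 3 ∧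
      (s : ℝ) * ((s : ℝ) + 1) ^ 2 ≤ ((s : ℝ) + 1) ^ 3 := by
  have hs : (0 : ℝ) ≤ s := Nat.cast_nonneg s
  have h1 : (1 : ℝ) ≤ (s : ℝ) + 1 := by linarith
  refine ⟨one_le_pow₀ h1, ?_, pow_le_pow_right₀ h1 (by norm_num), ?_⟩
  · nlinarith [one_le_pow₀ (n := 2) h1]
  · nlinarith [sq_nonneg ((s : ℝ) + 1)]

/-- **Height of `x(sP_b)`**: `h(x(sP_b)) ≤ C_b (s+1)²` for all `s ≥ 1` (Néron–Tate:
`h(sP) ≤ s² h(P) + (s²+1)C`, `HeightsMultiples.exists_naiveHeight_nsmul_le_and_le`).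
[cite: BakerWustholz2007, §6.8 (p. 116: h(ℓg) ≤ c₃ℓ²h(g) + c₄)] -/
theorem exists_logHeight₁_xsK_le {b : γ} (hb : B.latCo b = none) :
    ∃ C : ℝ, 0 ≤ C ∧ ∀ s : ℕ, s ≠ 0 → logHeight₁ (B.xsK s b) ≤ C * ((s : ℝ) + 1) ^ 2 := by
  obtain ⟨C, hC0, hC⟩ := WeierstrassCurve.Affine.Point.exists_naiveHeight_nsmul_le_and_le (W := B.WK)
  have hP0 : 0 ≤ WeierstrassCurve.Affine.Point.naiveHeight (B.PtK hb) :=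
    WeierstrassCurve.Affine.Point.naiveHeight_nonneg _
  refine ⟨WeierstrassCurve.Affine.Point.naiveHeight (B.PtK hb) + 2 * C, by positivity, fun s hs => ?_⟩
  obtain ⟨hns, e⟩ := B.nsmul_PtK hb hs
  have h1 := (hC s (Nat.one_le_iff_ne_zero.mpr hs) (B.PtK hb)).1
  have hx : WeierstrassCurve.Affine.Point.naiveHeight (s • B.PtK hb) = logHeight₁ (B.xsK s b) := by
    simp only [e, WeierstrassCurve.Affine.Point.naiveHeight_some]
  have h1' : logHeight₁ (B.xsK s b) ≤
      (s : ℝ) ^ 2 * WeierstrassCurve.Affine.Point.naiveHeight (B.PtK hb) + ((s : ℝ) ^ 2 + 1) * C := by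
    convert h1 using 2
    rw [← hx]
    congr!
  have hs0 : (0 : ℝ) ≤ s := Nat.cast_nonneg s
  nlinarith [h1', hP0, hC0]

/-- **Height of `y(sP_b)`**: `h(y(sP_b)) ≤ C_b (s+1)²` for `s ≥ 1` (`y² = x³ + a₄x + a₆`). [folklore] -/
theorem exists_logHeight₁_ysK_le {b : γ} (hb : B.latCo b = none) :
    ∃ C : ℝ, 0 ≤ C ∧ ∀ s : ℕ, s ≠ 0 → logHeight₁ (B.ysK s b) ≤ C * ((s : ℝ) + 1) ^ 2 := by
  obtain ⟨C, hC0, hC⟩ := B.exists_logHeight₁_xsK_le hb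
  have htw : 0 ≤ B.tw := Nat.cast_nonneg _
  set A : ℝ := logHeight₁ (-B.g2K / 4) + logHeight₁ (-B.g3K / 4) + 2 * (B.tw * Real.log 2) with hA
  have hA0 : 0 ≤ A := by
    have := zero_le_logHeight₁ (-B.g2K / 4); have := zero_le_logHeight₁ (-B.g3K / 4)
    have : 0 ≤ Real.log 2 := Real.log_nonneg (by norm_num)
    positivity
  refine ⟨2 * C + A, by positivity, fun s hs => ?_⟩
  obtain ⟨hns, -⟩ := B.nsmul_PtK hb hs
  have heq : B.ysK s b ^ 2 = B.xsK s b ^ 3 + (-B.g2K / 4) * B.xsK s b + (-B.g3K / 4) := by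
    have h := hns.1
    rw [WeierstrassCurve.Affine.equation_iff] at h
    simp only [WK] at h
    linear_combination h
  have h2 : (2 : ℝ) * logHeight₁ (B.ysK s b) = logHeight₁ (B.ysK s b ^ 2) := by
    rw [logHeight₁_pow]; norm_num
  have hx := hC s hs
  have hx0 := zero_le_logHeight₁ (B.xsK s b)
  have h3 : logHeight₁ (B.ysK s b ^ 2) ≤ 4 * logHeight₁ (B.xsK s b) + A := by
    rw [heq]
    calc logHeight₁ (B.xsK s b ^ 3 + -B.g2K / 4 * B.xsK s b + -B.g3K / 4)
        ≤ B.tw * Real.log 2 + logHeight₁ (B.xsK s b ^ 3 + -B.g2K / 4 * B.xsK s b) + logHeight₁ (-B.g3K / 4) :=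
          logHeight₁_add_le _ _
      _ ≤ B.tw * Real.log 2 + (B.tw * Real.log 2 + logHeight₁ (B.xsK s b ^ 3) + logHeight₁ (-B.g2K / 4 * B.xsK s b)) +
            logHeight₁ (-B.g3K / 4) := by gcongr; exact logHeight₁_add_le _ _
      _ ≤ B.tw * Real.log 2 + (B.tw * Real.log 2 + 3 * logHeight₁ (B.xsK s b) +
            (logHeight₁ (-B.g2K / 4) + logHeight₁ (B.xsK s b))) + logHeight₁ (-B.g3K / 4) := by
          gcongr
          · exact (logHeight₁_pow _ 3).le
          · exact logHeight₁_mul_le _ _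
      _ = 4 * logHeight₁ (B.xsK s b) + A := by rw [hA]; ring
  have h1s : (1 : ℝ) ≤ ((s : ℝ) + 1) ^ 2 := one_le_pow₀ (by have : (0:ℝ) ≤ s := Nat.cast_nonneg s; linarith)
  nlinarith [h2, h3, hx, hA0, h1s]

/-- **Height of the slopes**: `h(slope_j) ≤ C_b (j+1)²` for `j ≥ 1`. [folklore] -/
theorem exists_logHeight₁_slopeK_le {b : γ} (hb : B.latCo b = none) :
    ∃ C : ℝ, 0 ≤ C ∧ ∀ j : ℕ, j ≠ 0 → logHeight₁ (B.slopeK j b) ≤ C * ((j : ℝ) + 1) ^ 2 := by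
  obtain ⟨Cx, hCx0, hCx⟩ := B.exists_logHeight₁_xsK_le hb
  obtain ⟨Cy, hCy0, hCy⟩ := B.exists_logHeight₁_ysK_le hb
  have htw : 0 ≤ B.tw := Nat.cast_nonneg _
  have hl2 : 0 ≤ Real.log 2 := Real.log_nonneg (by norm_num)
  set A : ℝ := logHeight₁ (B.slopeK 1 b) + 2 * (B.tw * Real.log 2) + logHeight₁ (B.pyK b) + logHeight₁ (B.pxK b)
    with hA
  have hA0 : 0 ≤ A := by
    have := zero_le_logHeight₁ (B.slopeK 1 b); have := zero_le_logHeight₁ (B.pyK b)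
    have := zero_le_logHeight₁ (B.pxK b)
    positivity
  refine ⟨Cx + Cy + A, by positivity, fun j hj => ?_⟩
  have h1j : (1 : ℝ) ≤ ((j : ℝ) + 1) ^ 2 := one_le_pow₀ (by have : (0:ℝ) ≤ j := Nat.cast_nonneg j; linarith)
  by_cases h1 : j = 1
  · subst h1
    have : logHeight₁ (B.slopeK 1 b) ≤ A := by
      rw [hA]; have := zero_le_logHeight₁ (B.pyK b); have := zero_le_logHeight₁ (B.pxK b); nlinarith
    nlinarith
  · rw [slopeK, if_neg h1]
    have hx := hCx j hj; have hy := hCy j hj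
    calc logHeight₁ ((B.ysK j b - B.pyK b) / (B.xsK j b - B.pxK b))
        ≤ logHeight₁ (B.ysK j b - B.pyK b) + logHeight₁ (B.xsK j b - B.pxK b) := logHeight₁_div_le _ _
      _ ≤ (B.tw * Real.log 2 + logHeight₁ (B.ysK j b) + logHeight₁ (B.pyK b)) +
            (B.tw * Real.log 2 + logHeight₁ (B.xsK j b) + logHeight₁ (B.pxK b)) :=
          add_le_add (logHeight₁_sub_le _ _) (logHeight₁_sub_le _ _)
      _ ≤ (Cx + Cy + A) * ((j : ℝ) + 1) ^ 2 := by
          rw [hA]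
          have := zero_le_logHeight₁ (B.slopeK 1 b)
          nlinarith

/-- **Height of the `ζ`-chain**: `h(Z_s) ≤ C_b (s+1)³` for all `s`. [folklore] -/
theorem exists_logHeight₁_ZK_le {b : γ} (hb : B.latCo b = none) :
    ∃ C : ℝ, 0 ≤ C ∧ ∀ s : ℕ, logHeight₁ (B.ZK s b) ≤ C * ((s : ℝ) + 1) ^ 3 := by
  obtain ⟨C, hC0, hC⟩ := B.exists_logHeight₁_slopeK_le hb
  have htw : 0 ≤ B.tw := Nat.cast_nonneg _
  refine ⟨B.tw + C, by positivity, fun s => ?_⟩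
  obtain ⟨c1, c2, c3, c4⟩ := cube_facts s
  rw [ZK]
  refine (logHeight₁_sum_le _ _).trans ?_
  have hcard : ((Finset.Ico 1 s).card : ℝ) ≤ s := by
    rw [Nat.card_Ico]; exact_mod_cast Nat.sub_le s 1
  have hlog : Real.log ((Finset.Ico 1 s).card : ℝ) ≤ s :=
    (Real.log_le_self (Nat.cast_nonneg _)).trans hcard
  have hsum : ∑ j ∈ Finset.Ico 1 s, logHeight₁ (B.slopeK j b) ≤ ∑ _j ∈ Finset.Ico 1 s, C * ((s : ℝ) + 1) ^ 2 := by
    refine Finset.sum_le_sum fun j hj => ?_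
    rw [Finset.mem_Ico] at hj
    refine (hC j (by omega)).trans (mul_le_mul_of_nonneg_left ?_ hC0)
    have : (j : ℝ) ≤ s := by exact_mod_cast hj.2.le
    have : (0 : ℝ) ≤ j := Nat.cast_nonneg j
    nlinarith
  rw [Finset.sum_const, nsmul_eq_mul] at hsum
  have htot : (totalWeight B.K : ℝ) * Real.log ((Finset.Ico 1 s).card : ℝ) ≤ B.tw * ((s : ℝ) + 1) ^ 3 :=
    mul_le_mul_of_nonneg_left (hlog.trans c2) htw
  have hB : ((Finset.Ico 1 s).card : ℝ) * (C * ((s : ℝ) + 1) ^ 2) ≤ C * ((s : ℝ) + 1) ^ 3 :=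
    calc ((Finset.Ico 1 s).card : ℝ) * (C * ((s : ℝ) + 1) ^ 2) ≤ (s : ℝ) * (C * ((s : ℝ) + 1) ^ 2) :=
          mul_le_mul_of_nonneg_right hcard (by positivity)
      _ = C * ((s : ℝ) * ((s : ℝ) + 1) ^ 2) := by ring
      _ ≤ C * ((s : ℝ) + 1) ^ 3 := mul_le_mul_of_nonneg_left c4 hC0
  linarith [htot, hsum, hB]

/-- **Height of the fibre contributions**: `h(fibK s b) ≤ C_b (s+1)³`. [folklore] -/
theorem exists_logHeight₁_fibK_le (b : γ) :
    ∃ C : ℝ, 0 ≤ C ∧ ∀ s : ℕ, logHeight₁ (B.fibK s b) ≤ C * ((s : ℝ) + 1) ^ 3 := by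
  have htw : 0 ≤ B.tw := Nat.cast_nonneg _
  have hl2 : 0 ≤ Real.log 2 := Real.log_nonneg (by norm_num)
  have hτ := zero_le_logHeight₁ (B.tauK b)
  have hsτ : ∀ s : ℕ, logHeight₁ ((s : B.K) * B.tauK b) ≤ (B.tw + logHeight₁ (B.tauK b)) * ((s : ℝ) + 1) ^ 3 := by
    intro s
    obtain ⟨c1, c2, -, -⟩ := cube_facts s
    calc logHeight₁ ((s : B.K) * B.tauK b) ≤ logHeight₁ (s : B.K) + logHeight₁ (B.tauK b) := logHeight₁_mul_le _ _
      _ ≤ B.tw * s + logHeight₁ (B.tauK b) := by gcongr; exact logHeight₁_natCast_le' s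
      _ ≤ (B.tw + logHeight₁ (B.tauK b)) * ((s : ℝ) + 1) ^ 3 := by nlinarith
  rcases hb : B.latCo b with _ | mn
  · obtain ⟨C, hC0, hC⟩ := B.exists_logHeight₁_ZK_le hb
    refine ⟨B.tw * Real.log 2 + (B.tw + logHeight₁ (B.tauK b)) + C, by positivity, fun s => ?_⟩
    obtain ⟨c1, -, -, -⟩ := cube_facts s
    unfold fibK; rw [hb]
    by_cases hs : s = 0
    · simp only [hs, if_true, logHeight₁_zero]; positivity
    · simp only [hs, if_false]
      have e1 : B.tw * Real.log 2 ≤ B.tw * Real.log 2 * ((s : ℝ) + 1) ^ 3 := le_mul_of_one_le_right (by positivity) c1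
      have e2 := hsτ s
      have e3 := hC s
      have e4 := logHeight₁_sub_le ((s : B.K) * B.tauK b) (B.ZK s b)
      linarith
  · refine ⟨B.tw + logHeight₁ (B.tauK b), by positivity, fun s => ?_⟩
    unfold fibK; rw [hb]
    exact hsτ s

/-- **Height of the factor generators**: `h(facK s b i) ≤ C_b (s+1)³`. [folklore] -/
theorem exists_logHeight₁_facK_le (b : γ) :
    ∃ C : ℝ, 0 ≤ C ∧ ∀ (s : ℕ) (i : Fin 2), logHeight₁ (B.facK s b i) ≤ C * ((s : ℝ) + 1) ^ 3 := by
  rcases hb : B.latCo b with _ | mn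
  · obtain ⟨Cx, hCx0, hCx⟩ := B.exists_logHeight₁_xsK_le hb
    obtain ⟨Cy, hCy0, hCy⟩ := B.exists_logHeight₁_ysK_le hb
    have h2 := zero_le_logHeight₁ (2 : B.K)
    refine ⟨Cx + Cy + logHeight₁ (2 : B.K), by positivity, fun s i => ?_⟩
    obtain ⟨c1, -, c3, -⟩ := cube_facts s
    unfold facK; rw [hb]
    by_cases hs : s = 0
    · simp only [hs, if_true, logHeight₁_zero]; positivity
    · simp only [hs, if_false]
      fin_cases i
      · simp only [Fin.zero_eta, Fin.isValue, if_true]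
        nlinarith [hCx s hs]
      · simp only [Fin.mk_one, Fin.isValue, one_ne_zero, if_false]
        calc logHeight₁ (2 * B.ysK s b) ≤ logHeight₁ (2 : B.K) + logHeight₁ (B.ysK s b) := logHeight₁_mul_le _ _
          _ ≤ logHeight₁ (2 : B.K) * ((s : ℝ) + 1) ^ 3 + Cy * ((s : ℝ) + 1) ^ 3 := by
              gcongr
              · exact le_mul_of_one_le_right h2 c1
              · exact (hCy s hs).trans (mul_le_mul_of_nonneg_left c3 hCy0)
          _ ≤ _ := by nlinarith
  · refine ⟨0, le_rfl, fun s i => ?_⟩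
    unfold facK; rw [hb]
    simp

/-- **Heights of the generator values: `logHeight₁ (gK s i) ≤ Cg·(s+1)³`** for one constant
`Cg ≥ 0` depending only on the data (torus: `s·h(e^{y_j})`; factors and fibres: above).
[cite: BakerWustholz2007, §6.8 (p. 119: log max |X_i(sγ)| ≪ s²)] -/
theorem exists_logHeight₁_gK_le :
    ∃ C : ℝ, 0 ≤ C ∧ ∀ (s : ℕ) (i : Gen β γ δ), logHeight₁ (B.gK s i) ≤ C * ((s : ℝ) + 1) ^ 3 := by
  classical
  have htw : 0 ≤ B.tw := Nat.cast_nonneg _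
  have hl2 : 0 ≤ Real.log 2 := Real.log_nonneg (by norm_num)
  choose Cf hCf0 hCf using B.exists_logHeight₁_facK_le
  choose Cφ hCφ0 hCφ using B.exists_logHeight₁_fibK_le
  -- torus constant
  set Ct : ℝ := ∑ j, logHeight₁ (B.torK j) with hCt
  have hCt0 : 0 ≤ Ct := Finset.sum_nonneg fun j _ => zero_le_logHeight₁ _
  -- fibre constant
  set Cκ : ℝ := ∑ e, ∑ b, logHeight₁ (B.κK e b) with hCκ
  have hCκ0 : 0 ≤ Cκ := Finset.sum_nonneg fun _ _ => Finset.sum_nonneg fun _ _ => zero_le_logHeight₁ _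
  set Ca : ℝ := ∑ e, logHeight₁ (B.aaK e) with hCa
  have hCa0 : 0 ≤ Ca := Finset.sum_nonneg fun _ _ => zero_le_logHeight₁ _
  set Cfib : ℝ := B.tw * Real.log 2 + (B.tw + Ca) + (B.tw * (Fintype.card γ : ℝ) + (Cκ + ∑ b, Cφ b)) with hCfib
  have hCfib0 : 0 ≤ Cfib := by
    have : 0 ≤ ∑ b, Cφ b := Finset.sum_nonneg fun b _ => hCφ0 b
    positivity
  refine ⟨Ct + ∑ b, Cf b + Cfib, by have := Finset.sum_nonneg fun b (_ : b ∈ Finset.univ) => hCf0 b; positivity,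
    fun s i => ?_⟩
  obtain ⟨c1, c2, c3, c4⟩ := cube_facts s
  have hsumf : 0 ≤ ∑ b, Cf b := Finset.sum_nonneg fun b _ => hCf0 b
  rcases i with j | ⟨b, i⟩ | e
  · -- torus
    simp only [gK, logHeight₁_pow]
    have hj : logHeight₁ (B.torK j) ≤ Ct :=
      Finset.single_le_sum (f := fun j' => logHeight₁ (B.torK j')) (fun _ _ => zero_le_logHeight₁ _) (Finset.mem_univ j)
    have := zero_le_logHeight₁ (B.torK j)
    nlinarith
  · -- factors
    simp only [gK]
    have hb : Cf b ≤ ∑ b', Cf b' := Finset.single_le_sum (f := Cf) (fun b' _ => hCf0 b') (Finset.mem_univ b)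
    have := hCf b s i
    nlinarith
  · -- fibre
    simp only [gK]
    have hsa : logHeight₁ ((s : B.K) * B.aaK e) ≤ (B.tw + Ca) * ((s : ℝ) + 1) ^ 3 := by
      have hae : logHeight₁ (B.aaK e) ≤ Ca :=
        Finset.single_le_sum (f := fun e' => logHeight₁ (B.aaK e')) (fun _ _ => zero_le_logHeight₁ _) (Finset.mem_univ e)
      calc logHeight₁ ((s : B.K) * B.aaK e) ≤ logHeight₁ (s : B.K) + logHeight₁ (B.aaK e) := logHeight₁_mul_le _ _
        _ ≤ B.tw * s + Ca := add_le_add (logHeight₁_natCast_le' s) hae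
        _ ≤ (B.tw + Ca) * ((s : ℝ) + 1) ^ 3 := by nlinarith
    have hsum : logHeight₁ (∑ b, B.κK e b * B.fibK s b) ≤
        (B.tw * (Fintype.card γ : ℝ) + (Cκ + ∑ b, Cφ b)) * ((s : ℝ) + 1) ^ 3 := by
      refine (logHeight₁_sum_le _ _).trans ?_
      have hlog : Real.log ((Finset.univ : Finset γ).card : ℝ) ≤ (Fintype.card γ : ℝ) := by
        rw [Finset.card_univ]; exact Real.log_le_self (Nat.cast_nonneg _)
      have hterm : ∀ b, logHeight₁ (B.κK e b * B.fibK s b) ≤ (logHeight₁ (B.κK e b) + Cφ b) * ((s : ℝ) + 1) ^ 3 := by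
        intro b
        calc logHeight₁ (B.κK e b * B.fibK s b) ≤ logHeight₁ (B.κK e b) + logHeight₁ (B.fibK s b) :=
              logHeight₁_mul_le _ _
          _ ≤ logHeight₁ (B.κK e b) * ((s : ℝ) + 1) ^ 3 + Cφ b * ((s : ℝ) + 1) ^ 3 :=
              add_le_add (le_mul_of_one_le_right (zero_le_logHeight₁ _) c1) (hCφ b s)
          _ = _ := by ring
      have hκe : ∑ b, logHeight₁ (B.κK e b) ≤ Cκ :=
        Finset.single_le_sum (f := fun e' => ∑ b, logHeight₁ (B.κK e' b))
          (fun _ _ => Finset.sum_nonneg fun _ _ => zero_le_logHeight₁ _) (Finset.mem_univ e)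
      calc (totalWeight B.K : ℝ) * Real.log ((Finset.univ : Finset γ).card : ℝ) + ∑ b, logHeight₁ (B.κK e b * B.fibK s b)
          ≤ B.tw * (Fintype.card γ : ℝ) + ∑ b, (logHeight₁ (B.κK e b) + Cφ b) * ((s : ℝ) + 1) ^ 3 :=
            add_le_add (mul_le_mul_of_nonneg_left hlog htw) (Finset.sum_le_sum fun b _ => hterm b)
        _ = B.tw * (Fintype.card γ : ℝ) + (∑ b, logHeight₁ (B.κK e b) + ∑ b, Cφ b) * ((s : ℝ) + 1) ^ 3 := by
            rw [← Finset.sum_mul, Finset.sum_add_distrib]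
        _ ≤ B.tw * (Fintype.card γ : ℝ) * ((s : ℝ) + 1) ^ 3 + (Cκ + ∑ b, Cφ b) * ((s : ℝ) + 1) ^ 3 := by
            have e1 : B.tw * (Fintype.card γ : ℝ) ≤ B.tw * (Fintype.card γ : ℝ) * ((s : ℝ) + 1) ^ 3 :=
              le_mul_of_one_le_right (by positivity) c1
            have e2 : (∑ b, logHeight₁ (B.κK e b) + ∑ b, Cφ b) * ((s : ℝ) + 1) ^ 3 ≤
                (Cκ + ∑ b, Cφ b) * ((s : ℝ) + 1) ^ 3 :=
              mul_le_mul_of_nonneg_right (by linarith) (by positivity)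
            linarith
        _ = _ := by ring
    have e1 : B.tw * Real.log 2 ≤ B.tw * Real.log 2 * ((s : ℝ) + 1) ^ 3 := le_mul_of_one_le_right (by positivity) c1
    have e2 := logHeight₁_add_le ((s : B.K) * B.aaK e) (∑ b, B.κK e b * B.fibK s b)
    have e3 : Cfib * ((s : ℝ) + 1) ^ 3 ≤ (Ct + ∑ b, Cf b + Cfib) * ((s : ℝ) + 1) ^ 3 :=
      mul_le_mul_of_nonneg_right (by linarith) (by positivity)
    have e4 : B.tw * Real.log 2 * ((s : ℝ) + 1) ^ 3 + (B.tw + Ca) * ((s : ℝ) + 1) ^ 3 +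
        (B.tw * (Fintype.card γ : ℝ) + (Cκ + ∑ b, Cφ b)) * ((s : ℝ) + 1) ^ 3 = Cfib * ((s : ℝ) + 1) ^ 3 := by
      rw [hCfib]; ring
    linarith

end Heights

/-! ### The interface: conjugate bounds and per-`s` denominators -/

/-- **The height constant `Cg ≥ 0`** of the data: `logHeight₁ (gK s i) ≤ Cg·(s+1)³`. [folklore] -/
def Cg : ℝ := B.exists_logHeight₁_gK_le.choose

/-- `0 ≤ Cg`. [folklore] -/
theorem Cg_nonneg : 0 ≤ B.Cg := B.exists_logHeight₁_gK_le.choose_spec.1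

/-- **`logHeight₁ (gK s i) ≤ Cg·(s+1)³`.** [cite: BakerWustholz2007, §6.8 (p. 119)] -/
theorem logHeight₁_gK_le (s : ℕ) (i : Gen β γ δ) : logHeight₁ (B.gK s i) ≤ B.Cg * ((s : ℝ) + 1) ^ 3 :=
  B.exists_logHeight₁_gK_le.choose_spec.2 s i

/-- The base `Mg = e^{Cg} ≥ 1` of the conjugate bounds. [folklore] -/
def Mg : ℝ := Real.exp B.Cg

/-- `1 ≤ Mg`. [folklore] -/
theorem one_le_Mg : 1 ≤ B.Mg := Real.one_le_exp B.Cg_nonneg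

/-- **The conjugate bound at `s·v`: `gBound s = Mg^{(s+1)³}`.** [folklore] -/
def gBound (s : ℕ) : ℝ := B.Mg ^ ((s + 1) ^ 3)

/-- `1 ≤ gBound s`. [folklore] -/
theorem one_le_gBound (s : ℕ) : 1 ≤ B.gBound s := one_le_pow₀ B.one_le_Mg

/-- `gBound` is monotone. [folklore] -/
theorem gBound_mono {s s' : ℕ} (h : s ≤ s') : B.gBound s ≤ B.gBound s' :=
  pow_le_pow_right₀ B.one_le_Mg (Nat.pow_le_pow_left (Nat.succ_le_succ h) 3)

/-- `exp(Cg (s+1)³) = gBound s`. [folklore] -/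
theorem exp_Cg_mul_eq (s : ℕ) : Real.exp (B.Cg * ((s : ℝ) + 1) ^ 3) = B.gBound s := by
  rw [gBound, Mg, ← Real.exp_nat_mul, mul_comm]
  push_cast
  ring_nf

/-- **Conjugates at `s·v`**: `‖σ(gK s i)‖ ≤ gBound s` for every embedding `σ : K → ℂ`
(conjugates are bounded by the height). [cite: BakerWustholz2007, §6.8 (p. 119: log max |X_i(sγ)| ≪ s²)] -/
theorem norm_embedding_gK_le (σ : B.K →+* ℂ) (s : ℕ) (i : Gen β γ δ) : ‖σ (B.gK s i)‖ ≤ B.gBound s := by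
  refine (norm_embedding_le_exp_logHeight₁ σ _).trans ?_
  rw [← B.exp_Cg_mul_eq]
  exact Real.exp_le_exp.mpr (B.logHeight₁_gK_le s i)

/-- A denominator of `gK s i` bounded by its height (choice). [folklore] -/
def genDen (s : ℕ) (i : Gen β γ δ) : ℕ := (exists_nat_den_le_exp_logHeight₁ (B.gK s i)).choose

/-- The defining properties of `genDen`. [folklore] -/
theorem genDen_spec (s : ℕ) (i : Gen β γ δ) :
    1 ≤ B.genDen s i ∧ (B.genDen s i : ℝ) ≤ B.gBound s ∧ IsIntegral ℤ ((B.genDen s i : B.K) * B.gK s i) := by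
  obtain ⟨h1, h2, h3⟩ := (exists_nat_den_le_exp_logHeight₁ (B.gK s i)).choose_spec
  refine ⟨h1, h2.trans ?_, h3⟩
  rw [← B.exp_Cg_mul_eq]
  exact Real.exp_le_exp.mpr (B.logHeight₁_gK_le s i)

/-- **The per-`s` denominator `pden s = ∏_i genDen s i ∈ ℕ`** clearing all generator values at
`s·v` at once. [folklore] -/
def pden (s : ℕ) : ℕ := ∏ i : Gen β γ δ, B.genDen s i

/-- `1 ≤ pden s`. [folklore] -/
theorem one_le_pden (s : ℕ) : 1 ≤ B.pden s :=
  Finset.one_le_prod' fun i _ => (B.genDen_spec s i).1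

/-- `pden s ≠ 0`. [folklore] -/
theorem pden_ne_zero (s : ℕ) : B.pden s ≠ 0 := Nat.one_le_iff_ne_zero.mp (B.one_le_pden s)

/-- **`pden s · gK s i ∈ 𝓞_K`.** [cite: BakerWustholz2007, §6.8 (p. 119: denominators)] -/
theorem isIntegral_pden_mul_gK (s : ℕ) (i : Gen β γ δ) : IsIntegral ℤ ((B.pden s : B.K) * B.gK s i) := by
  classical
  rw [pden, ← Finset.mul_prod_erase Finset.univ (B.genDen s) (Finset.mem_univ i)]
  push_cast
  rw [mul_comm ((B.genDen s i : B.K)) _, mul_assoc]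
  have h2 : IsIntegral ℤ (((∏ j ∈ Finset.univ.erase i, B.genDen s j : ℕ) : B.K)) := by
    exact_mod_cast isIntegral_algebraMap (R := ℤ) (A := B.K) (x := ((∏ j ∈ Finset.univ.erase i, B.genDen s j : ℕ) : ℤ))
  push_cast at h2
  exact h2.mul (B.genDen_spec s i).2.2

/-- **Size of the per-`s` denominator**: `pden s ≤ gBound s ^ #Gen`. [folklore] -/
theorem pden_le (s : ℕ) : (B.pden s : ℝ) ≤ B.gBound s ^ Fintype.card (Gen β γ δ) := by
  rw [pden, Nat.cast_prod, ← Finset.card_univ, ← Finset.prod_const]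
  exact Finset.prod_le_prod (fun i _ => Nat.cast_nonneg _) fun i _ => (B.genDen_spec s i).2.1

end BakerDataG

end Std

end GaGmE

end Literature.NumberTheory.Transcendental

end
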